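import Literature.AlgebraicGeometry.Modules.Biduality
import Literature.AlgebraicGeometry.GroupSchemes.CotangentSheafFreeOverLocalRing
import HarnessLib

/-!
# Every functional on the dual of a finite locally free module is evaluation at a global section

For an `𝒪_X`-module `E` on a scheme `X` with dual `E^∨ = dual E = 𝓗om(E, 𝒪_X)`
(`Modules/LocalFrames.lean`; sections over `V` = morphisms `E|_V → 𝒪_X|_V`), a morphism of
`𝒪_X`-modules `Φ : E^∨ → 𝒪_X` restricts to a global section `Φ|_X ∈ Γ(X, E^∨∨) = Hom(E^∨|_X, 𝒪_X|_X)`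
of the double dual.  By biduality (Hartshorne II Ex. 5.1 (a), tree `Modules/Biduality.lean`:
`toBidual E 𝒪_X : E → E^∨∨`, `s ↦ ev_s`, is bijective on sections over every open as soon as `E` is
finite locally free) it is `ev_ω` for a unique global section `ω ∈ Γ(X, E)`; unfolded
(`hom_dual_app_eq_appLE_of_toBidual_app_eq`, `exists_section_hom_dual_app_eq_appLE`,
`section_eq_of_forall_appLE_eq`, `existsUnique_section_hom_dual_app_eq_appLE`):

  **`Φ_V(θ) = θ_V(ω|_V)` for every open `V` and every `θ : E|_V → 𝒪_X|_V`.**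

Specialised to the tangent sheaf `𝒯_{X/S} = (Ω¹_{X/S})^∨` (`HodgeTheory/AtiyahClassCoherent.lean`):
every module map `π : 𝒯_{X/S} → 𝒪_X` is «evaluation at a global `1`-form `ω_π ∈ Γ(X, Ω¹_{X/S})`»
whenever `Ω¹_{X/S}` is finite locally free (`HodgeTheory.exists_oneForm_tangentSheaf_hom_app_eq`), in
particular for an abelian scheme of relative dimension `g` over a local ring
(`AbelianSchemeOver.exists_oneForm_tangentSheaf_hom_app_eq_of_isLocalRing`, via the tree's frame
`Ω¹_{A/R} ≅ 𝒪_A^g`, `GroupSchemes/CotangentSheafFreeOverLocalRing.lean`) and for an abelian variety over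
a field (`AbelianVariety.exists_oneForm_tangentSheaf_hom_app_eq`, Mumford §4 (iii)).  This is the
dictionary «`π_a` = evaluation at `ω_a`» between frame projections of `𝒯` and global `1`-forms used by
the Čech obstruction calculus of cell hodgecm-mathlib (D-0151), F-11 ∕ J4-(iv) slot rel₁; HC_CM is
proved only modulo the 7 printed citations until rung 0 closes — nothing here bears on it.

THEOREMS ONLY (no definition, no named fact, no instance, no `sorry`).

## References

* R. Hartshorne, *Algebraic Geometry*, GTM 52 (1977), II Ex. 5.1 (a) (p. 123): `ℰ ≅ ℰ^∨∨` for `ℰ`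
  locally free of finite rank; II.8 (p. 180): the tangent sheaf as the dual of `Ω`. [Hartshorne1977]
* D. Mumford, *Abelian Varieties* (1970), §4 (iii) (p. 42): `Ω¹` of an abelian variety is free on
  the invariant differentials. [MumfordAV1970]
* The Stacks project, Tag 01C6 (finite locally free modules), Tag 01CM (sheaf Hom). [StacksProject]
-/

noncomputable section

open CategoryTheory AlgebraicGeometry Opposite TopologicalSpace

universe u

namespace Literature.AlgebraicGeometry.Modules

open Literature.AlgebraicGeometry.Motives

variable {X : Scheme.{u}} {E : X.Modules}

/-- **Reading off a preimage under biduality.**  If the global section `Φ|_X ∈ Γ(X, E^∨∨)` defined by a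
morphism `Φ : E^∨ → 𝒪_X` is `ev_ω = toBidual(ω)` for a global section `ω` of `E`, then
`Φ_V(θ) = θ_V(ω|_V)` for every open `V` and every functional `θ : E|_V → 𝒪_X|_V`.
[cite: Hartshorne1977, II Ex. 5.1 (a) (p. 123)] -/
theorem hom_dual_app_eq_appLE_of_toBidual_app_eq (Φ : dual E ⟶ unitModule X) (ω : Γ(E, ⊤))
    (h : (toBidual E (unitModule X)).app ⊤ ω =
      (show Γ(dual (dual E), ⊤) from (SheafOfModules.overFunctor _ ⊤).map Φ))
    (V : X.Opens) (θ : E.over V ⟶ (unitModule X).over V) :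
    Φ.app V θ = appLE θ (𝟙 V) (E.presheaf.map (homOfLE le_top).op ω) := by
  have h₁ : Φ.app V θ =
      appLE ((SheafOfModules.overFunctor _ ⊤).map Φ) (homOfLE le_top) (θ : Γ(dual E, V)) := rfl
  have h₂ : ((SheafOfModules.overFunctor _ ⊤).map Φ : (dual E).over ⊤ ⟶ (unitModule X).over ⊤) =
      ((toBidual E (unitModule X)).app ⊤ ω : (dual E).over ⊤ ⟶ (unitModule X).over ⊤) := h.symm
  rw [h₁, h₂]
  rfl

/-- **Every functional on the dual of a finite locally free module is evaluation at a global
section**: for `E` finite locally free and `Φ : E^∨ → 𝒪_X` a morphism of `𝒪_X`-modules there is a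
global section `ω ∈ Γ(X, E)` with `Φ_V(θ) = θ_V(ω|_V)` for all opens `V` and all `θ : E|_V → 𝒪_X|_V`
(surjectivity of `E → E^∨∨` on global sections, Hartshorne II Ex. 5.1 (a)).
[cite: Hartshorne1977, II Ex. 5.1 (a) (p. 123)] -/
theorem exists_section_hom_dual_app_eq_appLE (hE : IsFiniteLocallyFree E)
    (Φ : dual E ⟶ unitModule X) :
    ∃ ω : Γ(E, ⊤), ∀ (V : X.Opens) (θ : E.over V ⟶ (unitModule X).over V),
      Φ.app V θ = appLE θ (𝟙 V) (E.presheaf.map (homOfLE le_top).op ω) := by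
  obtain ⟨ω, hω⟩ := (toBidual_app_bijective_of_isFiniteLocallyFree E hE ⊤).2
    (show Γ(dual (dual E), ⊤) from (SheafOfModules.overFunctor _ ⊤).map Φ)
  exact ⟨ω, hom_dual_app_eq_appLE_of_toBidual_app_eq Φ ω hω⟩

/-- **The section is unique**: for `E` finite locally free, two global sections `ω, ω'` on which all
local functionals `θ : E|_V → 𝒪_X|_V` take the same value are equal (injectivity of `E → E^∨∨` on
global sections, Hartshorne II Ex. 5.1 (a)). [cite: Hartshorne1977, II Ex. 5.1 (a) (p. 123)] -/
theorem section_eq_of_forall_appLE_eq (hE : IsFiniteLocallyFree E) (ω ω' : Γ(E, ⊤))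
    (h : ∀ (V : X.Opens) (θ : E.over V ⟶ (unitModule X).over V),
      appLE θ (𝟙 V) (E.presheaf.map (homOfLE le_top).op ω) =
        appLE θ (𝟙 V) (E.presheaf.map (homOfLE le_top).op ω')) :
    ω = ω' := by
  refine (toBidual_app_bijective_of_isFiniteLocallyFree E hE ⊤).1 ?_
  change (evalAt ω : (dual E).over ⊤ ⟶ (unitModule X).over ⊤) = evalAt ω'
  refine hom_ext_of_appLE fun W k (μ : E.over W ⟶ (unitModule X).over W) => ?_
  rw [appLE_evalAt, appLE_evalAt, show k = homOfLE le_top from Subsingleton.elim _ _]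
  exact h W μ

/-- Existence and uniqueness together: for `E` finite locally free, every `Φ : E^∨ → 𝒪_X` is evaluation
at a UNIQUE global section of `E`. [cite: Hartshorne1977, II Ex. 5.1 (a) (p. 123)] -/
theorem existsUnique_section_hom_dual_app_eq_appLE (hE : IsFiniteLocallyFree E)
    (Φ : dual E ⟶ unitModule X) :
    ∃! ω : Γ(E, ⊤), ∀ (V : X.Opens) (θ : E.over V ⟶ (unitModule X).over V),
      Φ.app V θ = appLE θ (𝟙 V) (E.presheaf.map (homOfLE le_top).op ω) := by
  obtain ⟨ω, hω⟩ := exists_section_hom_dual_app_eq_appLE hE Φ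
  exact ⟨ω, hω, fun ω' hω' => section_eq_of_forall_appLE_eq hE ω' ω fun V θ => by
    rw [← hω' V θ, hω V θ]⟩

end Literature.AlgebraicGeometry.Modules

/-! ## The tangent sheaf: module maps `𝒯_{X/S} → 𝒪_X` are evaluations at global `1`-forms -/

namespace Literature.AlgebraicGeometry.HodgeTheory

open Literature.AlgebraicGeometry.Modules Literature.AlgebraicGeometry.Motives

universe v

variable {S : Type v} [CommRing S] (X : Over (Spec (CommRingCat.of S)))

/-- **A module map `π : 𝒯_{X/S} → 𝒪_X` is evaluation at a global `1`-form** when `Ω¹_{X/S}` is finite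
locally free (`𝒯 = (Ω¹)^∨`, so `π|_X ∈ Γ(X, (Ω¹)^∨∨) = Γ(X, Ω¹)` by biduality): there is
`ω ∈ Γ(X, Ω¹_{X/S})` with `π_V(θ) = θ_V(ω|_V)` for every open `V` and every local vector field
`θ ∈ Γ(V, 𝒯) = Hom(Ω¹|_V, 𝒪|_V)`. [cite: Hartshorne1977, II Ex. 5.1 (a) (p. 123) and II.8 (p. 180)] -/
theorem exists_oneForm_tangentSheaf_hom_app_eq (hΩ : IsFiniteLocallyFree (cotangentSheaf X))
    (π : tangentSheaf X ⟶ unitModule X.left) :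
    ∃ ω : Γ(cotangentSheaf X, ⊤), ∀ (V : X.left.Opens) (θ : Γ(tangentSheaf X, V)),
      π.app V θ = appLE θ (𝟙 V)
        ((cotangentSheaf X).presheaf.map (homOfLE (le_top : V ≤ ⊤)).op ω) :=
  exists_section_hom_dual_app_eq_appLE hΩ π

/-- Uniqueness of the `1`-form: global `1`-forms are separated by the local vector fields when
`Ω¹_{X/S}` is finite locally free. [cite: Hartshorne1977, II Ex. 5.1 (a) (p. 123)] -/
theorem oneForm_eq_of_forall_tangentSheaf_appLE_eq (hΩ : IsFiniteLocallyFree (cotangentSheaf X))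
    (ω ω' : Γ(cotangentSheaf X, ⊤))
    (h : ∀ (V : X.left.Opens) (θ : Γ(tangentSheaf X, V)),
      appLE θ (𝟙 V) ((cotangentSheaf X).presheaf.map (homOfLE (le_top : V ≤ ⊤)).op ω) =
        appLE θ (𝟙 V) ((cotangentSheaf X).presheaf.map (homOfLE (le_top : V ≤ ⊤)).op ω')) :
    ω = ω' :=
  section_eq_of_forall_appLE_eq hΩ ω ω' h

end Literature.AlgebraicGeometry.HodgeTheory

/-! ## Abelian schemes over a local ring and abelian varieties over a field -/

namespace Literature.AlgebraicGeometry.AbelianSchemes.AbelianSchemeOver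

open Literature.AlgebraicGeometry.Modules Literature.AlgebraicGeometry.Motives
open Literature.AlgebraicGeometry.HodgeTheory

variable {R : Type} [CommRing R] [IsLocalRing R] (A : AbelianSchemeOver (Spec (CommRingCat.of R)))
  {g : ℕ}

/-- **Frame projections of `𝒯_{A/R}` are evaluations at global `1`-forms** for an abelian scheme `A`
of relative dimension `g` over a LOCAL ring `R` (`Ω¹_{A/R} ≅ 𝒪_A^g` is free, tree
`nonempty_cotangentSheaf_iso_free_of_isLocalRing`): every module map `π : 𝒯_{A/R} → 𝒪_A` has a
global `1`-form `ω` with `π_V(θ) = θ_V(ω|_V)` for all `V`, `θ`.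
[cite: MumfordAV1970, §4 (iii) (p. 42)] [cite: Hartshorne1977, II Ex. 5.1 (a) (p. 123)] -/
theorem exists_oneForm_tangentSheaf_hom_app_eq_of_isLocalRing (hA : A.IsOfRelDim g)
    (π : tangentSheaf A.X ⟶ unitModule A.X.left) :
    ∃ ω : Γ(cotangentSheaf A.X, ⊤), ∀ (V : A.X.left.Opens) (θ : Γ(tangentSheaf A.X, V)),
      π.app V θ = appLE θ (𝟙 V)
        ((cotangentSheaf A.X).presheaf.map (homOfLE (le_top : V ≤ ⊤)).op ω) := by
  obtain ⟨e⟩ := nonempty_cotangentSheaf_iso_free_of_isLocalRing A hA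
  exact exists_oneForm_tangentSheaf_hom_app_eq A.X (isFiniteLocallyFree_of_iso_free e) π

/-- Uniqueness of that `1`-form over a local base. [cite: Hartshorne1977, II Ex. 5.1 (a) (p. 123)] -/
theorem oneForm_eq_of_forall_tangentSheaf_appLE_eq_of_isLocalRing (hA : A.IsOfRelDim g)
    (ω ω' : Γ(cotangentSheaf A.X, ⊤))
    (h : ∀ (V : A.X.left.Opens) (θ : Γ(tangentSheaf A.X, V)),
      appLE θ (𝟙 V) ((cotangentSheaf A.X).presheaf.map (homOfLE (le_top : V ≤ ⊤)).op ω) =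
        appLE θ (𝟙 V) ((cotangentSheaf A.X).presheaf.map (homOfLE (le_top : V ≤ ⊤)).op ω')) :
    ω = ω' := by
  obtain ⟨e⟩ := nonempty_cotangentSheaf_iso_free_of_isLocalRing A hA
  exact oneForm_eq_of_forall_tangentSheaf_appLE_eq A.X (isFiniteLocallyFree_of_iso_free e) ω ω' h

end Literature.AlgebraicGeometry.AbelianSchemes.AbelianSchemeOver

namespace Literature.AlgebraicGeometry.Motives.AbelianVariety

open Literature.AlgebraicGeometry.Modules Literature.AlgebraicGeometry.HodgeTheory

variable {k : Type} [Field k] (A : AbelianVariety k)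

/-- **Frame projections of `𝒯_A` are evaluations at global `1`-forms** for an abelian variety over a
field (`Ω¹_A` free on the invariant differentials, Mumford §4 (iii), tree
`Mumford1970_cotangentSheaf_abelianVariety_free_holds`): every module map `π : 𝒯_A → 𝒪_A` has a
global `1`-form `ω` with `π_V(θ) = θ_V(ω|_V)` for all `V`, `θ`.
[cite: MumfordAV1970, §4 (iii) (p. 42)] [cite: Hartshorne1977, II Ex. 5.1 (a) (p. 123)] -/
theorem exists_oneForm_tangentSheaf_hom_app_eq (π : tangentSheaf A.X ⟶ unitModule A.X.left) :
    ∃ ω : Γ(cotangentSheaf A.X, ⊤), ∀ (V : A.X.left.Opens) (θ : Γ(tangentSheaf A.X, V)),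
      π.app V θ = appLE θ (𝟙 V)
        ((cotangentSheaf A.X).presheaf.map (homOfLE (le_top : V ≤ ⊤)).op ω) := by
  obtain ⟨e⟩ := Mumford1970_cotangentSheaf_abelianVariety_free_holds k A
  exact HodgeTheory.exists_oneForm_tangentSheaf_hom_app_eq A.X (isFiniteLocallyFree_of_iso_free e) π

/-- Uniqueness of that `1`-form for an abelian variety over a field.
[cite: Hartshorne1977, II Ex. 5.1 (a) (p. 123)] -/
theorem oneForm_eq_of_forall_tangentSheaf_appLE_eq (ω ω' : Γ(cotangentSheaf A.X, ⊤))
    (h : ∀ (V : A.X.left.Opens) (θ : Γ(tangentSheaf A.X, V)),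
      appLE θ (𝟙 V) ((cotangentSheaf A.X).presheaf.map (homOfLE (le_top : V ≤ ⊤)).op ω) =
        appLE θ (𝟙 V) ((cotangentSheaf A.X).presheaf.map (homOfLE (le_top : V ≤ ⊤)).op ω')) :
    ω = ω' := by
  obtain ⟨e⟩ := Mumford1970_cotangentSheaf_abelianVariety_free_holds k A
  exact HodgeTheory.oneForm_eq_of_forall_tangentSheaf_appLE_eq A.X (isFiniteLocallyFree_of_iso_free e)
    ω ω' h

end Literature.AlgebraicGeometry.Motives.AbelianVariety

end
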